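import Summits.BirchSwinnertonDyer.BirchSwinnertonDyer.Theorems.AlignedTransportAtTwoMainConjectureOfRankZeroBSDAtTwoResolventLambdaParity
import Summits.BirchSwinnertonDyer.BirchSwinnertonDyer.Theorems.ByReductionTypeAtTwoTowerClass7831a
import Summits.BirchSwinnertonDyer.BirchSwinnertonDyer.Theorems.ByReductionTypeAtTwoTowerClass24213c
import Summits.BirchSwinnertonDyer.BirchSwinnertonDyer.Theorems.ByReductionTypeAtTwoTowerClass25861b
import HarnessLib

/-!
# Route `AlignedTransportAtTwo`, crux C2 `MainConjectureOfRankZeroBSDAtTwo` (stmt-BirchSwinnertonDyer-22298):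
# SEED ROWS of the Ferrero–Kida bound — `λ₂(ℚ(W[2])) ≥ 17` for `7831a1`, `≥ 33` for `24213c1`, `≥ 3` (and odd) for `25861b1`,
# and the same lower bounds for the value of any 2-rank certificate on their sextic towers

HONEST FRAMING (cell `bsd-f1-sign2`, WIDTH-5 attached prover seat `bsd-line-att-p3` gen 29, line `birth`, lead `bsd-line-att-p2`; `--supports`
stmt-BirchSwinnertonDyer-22298, closes nothing; BSD is NOT proved; crux C2 untouched).  THEOREMS ONLY; every row is CONDITIONAL on the Literature named fact
`IwasawaTheory.ferreroKida_classicalLambda_two_imaginaryQuadratic` (Ferrero 1980 / Kida 1979, Schettler 2014 Thm. 2; binder `hFK`) and on `μ₂(ℚ(W[2])) = 0` (the C2 input,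
binder `hμ`; for the certificate rows it follows from the certificate, g28).  KERNEL-DECIDED per seed: `Δ_min = −d·q²` (tree `M<seed>_Δ`), `d` squarefree, the prime
factors of `d`, `ord₂(p² − 1)`, and the value `Σ = Σ_{p ∣ d} 2^{ord₂(p²−1)−3}` (= `λ₂(ℚ(√−d)) + 1` by the fact):

| seed | `Δ_min` | `d` | `Σ` | row |
|---|---|---|---|---|
| 7831a1 | `−41³·191 = −7831·41²` | `41·191` | `2 + 16 = 18` | `λ₂(T) ≥ 17`; certificate value `≥ 17` |
| 24213c1 | `−3²⁰·7⁷·1153³ = −8071·(3¹⁰·7³·1153)²` | `7·1153` | `2 + 32 = 34` | `λ₂(T) ≥ 33`; certificate value `≥ 33` |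
| 25861b1 | `−11⁸·2351 = −2351·(11⁴)²` | `2351` | `4` | `λ₂(T) ≥ 3` (and g28's `≥ 3` again, now with `λ₂(ℚ(√−2351)) = 3` behind it) |

So on 7831a1 and 24213c1 the sextic tower's `2`-ranks must climb to `17` resp. `33` before two consecutive layers can agree (g28: certificate value `r ≥ λ₂(T)`): a `-data`
steer — no low-layer class-group computation can certify these two seeds.  General tool: p762441 `ferreroKidaSum_le_classicalLambda_divisionField_two_succ`.

References: [Schettler2014] Thm. 2; [Fukuda1994] Thm. 1 (2); [CremonaAlgorithms1997] Table 1 (the minimal models); this seat's `…ResolventLambdaParity`.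
-/

set_option linter.dupNamespace false
set_option autoImplicit false

noncomputable section

open scoped Classical NumberField

namespace Summit.BirchSwinnertonDyer.BirchSwinnertonDyer.Theorems.AlignedTransportAtTwoResolventLambdaParitySeeds

open Polynomial WeierstrassCurve IntermediateField Field NumberField Finset
  Literature.NumberTheory.EllipticCurves Literature.NumberTheory.EllipticCurves.Greenberg1999 Literature.NumberTheory.GaloisRepresentations
  Literature.NumberTheory.IwasawaTheory Literature.NumberTheory.NumberFields
  Summit.BirchSwinnertonDyer.Rank1Residual.F1Sign2
  Summit.BirchSwinnertonDyer.BirchSwinnertonDyer.Theorems.AlignedTransportAtTwoKilfordStratumShared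
  Summit.BirchSwinnertonDyer.BirchSwinnertonDyer.Theorems.AlignedTransportAtTwoResolventLambdaParity
  Summit.BirchSwinnertonDyer.BirchSwinnertonDyer.Theorems.TowerClass

/-! ## §1 Kernel arithmetic: the three Ferrero–Kida sums -/

/-- `ord₂(p² − 1)` for `p² − 1 = 2^k · m`, `m` odd. [folklore] -/
private theorem padicValNat_two_eq {n k m : ℕ} (h : n = 2 ^ k * m) (hm : ¬ 2 ∣ m) : padicValNat 2 n = k := by
  haveI : Fact (Nat.Prime 2) := ⟨Nat.prime_two⟩
  have hm0 : m ≠ 0 := fun h0 => hm (h0 ▸ dvd_zero 2)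
  rw [h, padicValNat.mul (by positivity) hm0, padicValNat.prime_pow, padicValNat.eq_zero_of_not_dvd hm, add_zero]

/-- `Σ(7831) = 2^{ord₂(41²−1)−3} + 2^{ord₂(191²−1)−3} = 2 + 16 = 18` (`41² − 1 = 2⁴·105`, `191² − 1 = 2⁷·285`). [cite: Schettler2014, Thm. 2] -/
theorem ferreroKidaSum_7831 : ∑ p ∈ (7831 : ℕ).primeFactors.erase 2, 2 ^ (padicValNat 2 (p ^ 2 - 1) - 3) = 18 := by
  have h : (7831 : ℕ).primeFactors.erase 2 = {41, 191} := by
    rw [show (7831 : ℕ) = 41 * 191 by norm_num, Nat.primeFactors_mul (by norm_num) (by norm_num),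
      Nat.Prime.primeFactors (by norm_num), Nat.Prime.primeFactors (by norm_num)]
    decide
  rw [h, Finset.sum_pair (by norm_num), padicValNat_two_eq (k := 4) (m := 105) (by norm_num) (by norm_num),
    padicValNat_two_eq (k := 7) (m := 285) (by norm_num) (by norm_num)]
  norm_num

/-- `Σ(8071) = 2^{ord₂(7²−1)−3} + 2^{ord₂(1153²−1)−3} = 2 + 32 = 34` (`7² − 1 = 2⁴·3`, `1153² − 1 = 2⁸·5193`). [cite: Schettler2014, Thm. 2] -/
theorem ferreroKidaSum_8071 : ∑ p ∈ (8071 : ℕ).primeFactors.erase 2, 2 ^ (padicValNat 2 (p ^ 2 - 1) - 3) = 34 := by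
  have h : (8071 : ℕ).primeFactors.erase 2 = {7, 1153} := by
    rw [show (8071 : ℕ) = 7 * 1153 by norm_num, Nat.primeFactors_mul (by norm_num) (by norm_num),
      Nat.Prime.primeFactors (by norm_num), Nat.Prime.primeFactors (by norm_num)]
    decide
  rw [h, Finset.sum_pair (by norm_num), padicValNat_two_eq (k := 4) (m := 3) (by norm_num) (by norm_num),
    padicValNat_two_eq (k := 8) (m := 5193) (by norm_num) (by norm_num)]
  norm_num

/-- `Σ(2351) = 2^{ord₂(2351²−1)−3} = 4` (`2351` prime, `2351² − 1 = 2⁵·172725`). [cite: Schettler2014, Thm. 2] -/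
theorem ferreroKidaSum_2351 : ∑ p ∈ (2351 : ℕ).primeFactors.erase 2, 2 ^ (padicValNat 2 (p ^ 2 - 1) - 3) = 4 := by
  have h : (2351 : ℕ).primeFactors.erase 2 = {2351} := by
    rw [Nat.Prime.primeFactors (by norm_num)]
    decide
  rw [h, Finset.sum_singleton, padicValNat_two_eq (k := 5) (m := 172725) (by norm_num) (by norm_num)]
  norm_num

/-! ## §2 The seed rows -/

/-- A square root of `Δ_W` in `ℚ̄`. [folklore] -/
private theorem exists_sq_eq_Δ (W : WeierstrassCurve ℚ) : ∃ δ : AlgebraicClosure ℚ, δ ^ 2 = ((W.Δ : ℚ) : AlgebraicClosure ℚ) := by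
  obtain ⟨z, hz⟩ := IsAlgClosed.exists_eq_mul_self ((W.Δ : ℚ) : AlgebraicClosure ℚ)
  exact ⟨z, by rw [sq, ← hz]⟩

/-- ★ **7831a1: `λ₂(ℚ(W[2])^{cyc}) ≥ 17`** for every cyclotomic `ℤ₂`-extension of `ℚ(7831a1[2])` with `μ = 0` (CONDITIONAL on Ferrero–Kida: `λ₂(ℚ(√−7831)) = 17`).
`Δ_min = −13163911 = −7831·41²`, `7831 = 41·191` squarefree. [cite: Schettler2014, Thm. 2] [cite: CremonaAlgorithms1997, Table 1] -/
theorem seventeen_le_classicalLambda_7831a1 (hFK : ferreroKida_classicalLambda_two_imaginaryQuadratic)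
    (κT : ZpExtension (c7831a1.divisionField 2) 2) (hκT : κT.IsCyclotomic) (hμ : ClassicalMuVanishes κT) : 17 ≤ classicalLambda κT := by
  obtain ⟨δ, hδ⟩ := exists_sq_eq_Δ c7831a1
  have hΔ : c7831a1.Δ = -((7831 : ℕ) : ℚ) * (41 : ℚ) ^ 2 := by rw [baseChange_int_Δ, M7831a1_Δ]; norm_num
  have hd : Squarefree (7831 : ℕ) := by
    rw [show (7831 : ℕ) = 41 * 191 by norm_num]
    exact (Nat.squarefree_mul (by norm_num)).mpr ⟨(Nat.prime_iff.mp (by norm_num)).squarefree, (Nat.prime_iff.mp (by norm_num)).squarefree⟩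
  have h := ferreroKidaSum_le_classicalLambda_divisionField_two_succ c7831a1 hFK hd (by norm_num) (by norm_num : (41 : ℚ) ≠ 0) hΔ hδ κT hκT hμ
  rw [ferreroKidaSum_7831] at h
  omega

/-- ★ **7831a1: every 2-rank certificate `rank₂ Cl(T_{n+1}) = rank₂ Cl(T_n)` on the sextic tower has value `≥ 17`** (CONDITIONAL on Ferrero–Kida; the certificate gives
`μ = 0` and `λ₂(T) ≤ rank₂ Cl(T_n)`, g28; `7831a1` is ON the Kilford stratum: `Δ_min ≡ 1 (mod 8)`). [cite: Fukuda1994, Thm. 1 (2), p. 264] [cite: Schettler2014, Thm. 2] -/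
theorem seventeen_le_classGroupPRank_of_rankCert_7831a1 (hFK : ferreroKida_classicalLambda_two_imaginaryQuadratic)
    (κT : ZpExtension (c7831a1.divisionField 2) 2) (hκT : κT.IsCyclotomic) {n : ℕ}
    (hcert : classGroupPRank κT (n + 1) = classGroupPRank κT n) : 17 ≤ classGroupPRank κT n := by
  obtain ⟨δ, hδ⟩ := exists_sq_eq_Δ c7831a1
  have hΔ : c7831a1.Δ = -((7831 : ℕ) : ℚ) * (41 : ℚ) ^ 2 := by rw [baseChange_int_Δ, M7831a1_Δ]; norm_num
  have hd : Squarefree (7831 : ℕ) := by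
    rw [show (7831 : ℕ) = 41 * 191 by norm_num]
    exact (Nat.squarefree_mul (by norm_num)).mpr ⟨(Nat.prime_iff.mp (by norm_num)).squarefree, (Nat.prime_iff.mp (by norm_num)).squarefree⟩
  have hs : OnKilfordStratumAtTwo c7831a1 :=
    (onKilfordStratumAtTwo_iff_minimalDiscriminantInt_emod_eight c7831a1 goodOrd_two_7831a1).mpr (by rw [minimalDiscriminantInt_7831a1]; norm_num)
  have h := ferreroKidaSum_le_classGroupPRank_succ_of_rankCert c7831a1 hFK not_hasRationalTwoTorsionX_7831a1 hs hd (by norm_num)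
    (by norm_num : (41 : ℚ) ≠ 0) hΔ hδ κT hκT hcert
  rw [ferreroKidaSum_7831] at h
  omega

/-- ★ **24213c1: `λ₂(ℚ(W[2])^{cyc}) ≥ 33`** (CONDITIONAL on Ferrero–Kida: `λ₂(ℚ(√−8071)) = 33`; granted `μ = 0`).  `Δ_min = −3²⁰·7⁷·1153³ = −8071·(3¹⁰·7³·1153)²`,
`8071 = 7·1153` squarefree. [cite: Schettler2014, Thm. 2] [cite: CremonaAlgorithms1997, Table 1] -/
theorem thirtythree_le_classicalLambda_24213c1 (hFK : ferreroKida_classicalLambda_two_imaginaryQuadratic)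
    (κT : ZpExtension (c24213c1.divisionField 2) 2) (hκT : κT.IsCyclotomic) (hμ : ClassicalMuVanishes κT) : 33 ≤ classicalLambda κT := by
  obtain ⟨δ, hδ⟩ := exists_sq_eq_Δ c24213c1
  have hΔ : c24213c1.Δ = -((8071 : ℕ) : ℚ) * (23352639471 : ℚ) ^ 2 := by rw [baseChange_int_Δ, M24213c1_Δ]; norm_num
  have hd : Squarefree (8071 : ℕ) := by
    rw [show (8071 : ℕ) = 7 * 1153 by norm_num]
    exact (Nat.squarefree_mul (by norm_num)).mpr ⟨(Nat.prime_iff.mp (by norm_num)).squarefree, (Nat.prime_iff.mp (by norm_num)).squarefree⟩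
  have h := ferreroKidaSum_le_classicalLambda_divisionField_two_succ c24213c1 hFK hd (by norm_num) (by norm_num : (23352639471 : ℚ) ≠ 0) hΔ hδ
    κT hκT hμ
  rw [ferreroKidaSum_8071] at h
  omega

/-- ★ **24213c1: every 2-rank certificate on the sextic tower has value `≥ 33`** (CONDITIONAL on Ferrero–Kida; `Δ_min ≡ 1 (mod 8)`).
[cite: Fukuda1994, Thm. 1 (2), p. 264] [cite: Schettler2014, Thm. 2] -/
theorem thirtythree_le_classGroupPRank_of_rankCert_24213c1 (hFK : ferreroKida_classicalLambda_two_imaginaryQuadratic)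
    (κT : ZpExtension (c24213c1.divisionField 2) 2) (hκT : κT.IsCyclotomic) {n : ℕ}
    (hcert : classGroupPRank κT (n + 1) = classGroupPRank κT n) : 33 ≤ classGroupPRank κT n := by
  obtain ⟨δ, hδ⟩ := exists_sq_eq_Δ c24213c1
  have hΔ : c24213c1.Δ = -((8071 : ℕ) : ℚ) * (23352639471 : ℚ) ^ 2 := by rw [baseChange_int_Δ, M24213c1_Δ]; norm_num
  have hd : Squarefree (8071 : ℕ) := by
    rw [show (8071 : ℕ) = 7 * 1153 by norm_num]
    exact (Nat.squarefree_mul (by norm_num)).mpr ⟨(Nat.prime_iff.mp (by norm_num)).squarefree, (Nat.prime_iff.mp (by norm_num)).squarefree⟩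
  have hs : OnKilfordStratumAtTwo c24213c1 :=
    (onKilfordStratumAtTwo_iff_minimalDiscriminantInt_emod_eight c24213c1 goodOrd_two_24213c1).mpr (by rw [minimalDiscriminantInt_24213c1]; norm_num)
  have h := ferreroKidaSum_le_classGroupPRank_succ_of_rankCert c24213c1 hFK not_hasRationalTwoTorsionX_24213c1 hs hd (by norm_num)
    (by norm_num : (23352639471 : ℚ) ≠ 0) hΔ hδ κT hκT hcert
  rw [ferreroKidaSum_8071] at h
  omega

/-- **25861b1: `λ₂(ℚ(W[2])^{cyc}) ≥ 3`** through the resolvent (`λ₂(ℚ(√−2351)) = 3`; CONDITIONAL on Ferrero–Kida, granted `μ = 0`) — the g26/g28 bound `≥ 3` recovered from the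
quadratic field, where a certificate of value `3` would pin `λ₂(T) = λ₂(ℚ(√−2351)) = 3`.  `Δ_min = −11⁸·2351`. [cite: Schettler2014, Thm. 2] [cite: CremonaAlgorithms1997, Table 1] -/
theorem three_le_classicalLambda_25861b1 (hFK : ferreroKida_classicalLambda_two_imaginaryQuadratic)
    (κT : ZpExtension (c25861b1.divisionField 2) 2) (hκT : κT.IsCyclotomic) (hμ : ClassicalMuVanishes κT) : 3 ≤ classicalLambda κT := by
  obtain ⟨δ, hδ⟩ := exists_sq_eq_Δ c25861b1
  have hΔ : c25861b1.Δ = -((2351 : ℕ) : ℚ) * (14641 : ℚ) ^ 2 := by rw [baseChange_int_Δ, M25861b1_Δ]; norm_num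
  have hd : Squarefree (2351 : ℕ) := (Nat.prime_iff.mp (by norm_num)).squarefree
  have h := ferreroKidaSum_le_classicalLambda_divisionField_two_succ c25861b1 hFK hd (by norm_num) (by norm_num : (14641 : ℚ) ≠ 0) hΔ hδ κT hκT hμ
  rw [ferreroKidaSum_2351] at h
  omega

end Summit.BirchSwinnertonDyer.BirchSwinnertonDyer.Theorems.AlignedTransportAtTwoResolventLambdaParitySeeds

end
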